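import Summits.CriticalPhenomena.SAWScalingLimit.Theses.SAWRenewalTightness

/-!
# Crux AnnularMassDecay (stmt-CriticalPhenomena-4729) — ideator 3 (gen 2), round 1
# Sketch for the idea card `first-passage-dyadic-coupling`

First-lemma statements (sorried, they only need to ELABORATE here):

* `fpMass_univ_le_one`  — Kesten in an arbitrary lattice direction `q`: the x_c-mass of
  FIRST-PASSAGE bridges from `u` past `q`-depth `t` is ≤ 1 (prefix-free family of Kesten bridges).
* `capMass_le_fpMass`   — the record-type ("cap") part of the crux's double sum is dominated by the
  first-passage profile on the transversal shadow of the target disc (injection, provable now).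
* `central_window_decay` — the DYADIC SIBLING LEMMA: exact additivity over sibling windows +
  a near-diagonal doubling hypothesis with ANY constant `c > 0` (top `K` levels skipped) give
  `(w/t)^{log₂(1+c)}` decay of the central window (pure bookkeeping, provable now).
* `annularMassDecay_of`  — the line concludes the crux BY NAME from CapDecay + SideDecay + FrameExists.

Research-grade Props (the stubs of the line): `NearDiagonalDoubling`, `SideDecay`.
-/

namespace Summit.CriticalPhenomena.SAWScalingLimit.Cruxes.AnnularMassDecay.Ideator3g2

open Literature.Probability.RandomPlanarGeometry Literature.Probability.LatticeModels
open scoped BigOperators Classical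

noncomputable section

/-! ### Frames: depth and transversal coordinate along an integer direction `q` -/

/-- `q`-depth of `v` below `u`: `⟨v - u, q⟩`. -/
def dq (q u v : Site 2) : ℤ := (v 0 - u 0) * q 0 + (v 1 - u 1) * q 1

/-- transversal coordinate of `v` in the `q`-frame at `u`: `⟨v - u, q^⊥⟩`. -/
def xq (q u v : Site 2) : ℤ := (v 0 - u 0) * q 1 - (v 1 - u 1) * q 0

/-- `ω` (an `n`-step walk read from `u`) is a FIRST PASSAGE past `q`-depth `t`: interior depths in
`(0, t)`, endpoint depth `≥ t`.  Such walks are (strict-record) Kesten bridges in direction `q`. -/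
def IsFP (q u : Site 2) (t : ℤ) (n : ℕ) (ω : ℕ → Site 2) : Prop :=
  1 ≤ n ∧ (∀ i, 0 < i → i < n → 0 < dq q u (u + ω i) ∧ dq q u (u + ω i) < t) ∧
    t ≤ dq q u (u + ω n)

/-- First-passage profile mass: x_c-mass (partial sums) of first passages past depth `t` whose
endpoint has transversal coordinate in the window `W`. -/
def fpMass (q u : Site 2) (t : ℤ) (W : Set ℤ) (N : ℕ) : ℝ :=
  ∑ n ∈ Finset.range (N + 1), ∑ _ω ∈ (SAW.Zd.saws 2 n).filter
    (fun ω => IsFP q u t n ω ∧ xq q u (u + ω n) ∈ W), SAW.criticalFugacity ^ n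

/-- KESTEN NORMALISATION in direction `q` (provable now: prefix-free family of bridges w.r.t. the
linear height `⟨·, q⟩`, unique irreducible factorisation, `A^{(q)}(x_c) ≤ 1` by `B^{(q)}(x) ≤ χ(x)`
for `x < x_c` and monotone convergence; cf. route items KestenIdentity / StripMassConservation). -/
theorem fpMass_univ_le_one (q u : Site 2) (hq : q ≠ 0) (t : ℤ) (ht : 1 ≤ t) (N : ℕ) :
    fpMass q u t Set.univ N ≤ 1 := by
  sorry

/-! ### The crux's family, split into cap (record) entries and side entries -/

/-- The crux's filter predicate, verbatim. -/
def IsAnn (z : ℂ) (r R : ℝ) (u : Site 2) (n : ℕ) (ω : ℕ → Site 2) : Prop :=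
  (∀ i, 0 < i → i < n → r < dist (Site.toComplex (u + ω i)) z ∧
    dist (Site.toComplex (u + ω i)) z < R) ∧ dist (Site.toComplex (u + ω n)) z ≤ r

/-- transversal shadow (in the `q`-frame at `u`) of the lattice points of the closed target disc. -/
def capWindow (q u : Site 2) (z : ℂ) (r : ℝ) : Set ℤ :=
  {x | ∃ v : Site 2, dist (Site.toComplex v) z ≤ r ∧ xq q u v = x}

/-- cap (record-type) entries: annular bridges that are ALSO first passages past `q`-depth `t`. -/
def capMass (q u : Site 2) (t : ℤ) (z : ℂ) (r R : ℝ) (N : ℕ) : ℝ :=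
  ∑ n ∈ Finset.range (N + 1), ∑ _ω ∈ (SAW.Zd.saws 2 n).filter
    (fun ω => IsAnn z r R u n ω ∧ IsFP q u t n ω), SAW.criticalFugacity ^ n

/-- side entries: the rest. -/
def sideMass (q u : Site 2) (t : ℤ) (z : ℂ) (r R : ℝ) (N : ℕ) : ℝ :=
  ∑ n ∈ Finset.range (N + 1), ∑ _ω ∈ (SAW.Zd.saws 2 n).filter
    (fun ω => IsAnn z r R u n ω ∧ ¬ IsFP q u t n ω), SAW.criticalFugacity ^ n

/-- The crux's double sum splits exactly (filter partition). Provable now. -/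
theorem ann_eq_cap_add_side (q u : Site 2) (t : ℤ) (z : ℂ) (r R : ℝ) (N : ℕ) :
    (∑ n ∈ Finset.range (N + 1), ∑ _ω ∈ (SAW.Zd.saws 2 n).filter (fun ω => IsAnn z r R u n ω),
      SAW.criticalFugacity ^ n) = capMass q u t z r R N + sideMass q u t z r R N := by
  classical
  unfold capMass sideMass
  rw [← Finset.sum_add_distrib]
  refine Finset.sum_congr rfl fun n _ => ?_
  rw [← Finset.sum_filter_add_sum_filter_not ((SAW.Zd.saws 2 n).filter (fun ω => IsAnn z r R u n ω))
    (fun ω => IsFP q u t n ω)]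
  congr 1
  · refine Finset.sum_congr ?_ fun _ _ => rfl
    ext ω
    simp only [Finset.mem_filter, and_assoc]
  · refine Finset.sum_congr ?_ fun _ _ => rfl
    ext ω
    simp only [Finset.mem_filter, and_assoc]

/-- CAP INJECTION (provable now): cap entries are first passages whose endpoint lies in the shadow
of the target disc. -/
theorem capMass_le_fpMass (q u : Site 2) (t : ℤ) (z : ℂ) (r R : ℝ) (N : ℕ) :
    capMass q u t z r R N ≤ fpMass q u t (capWindow q u z r) N := by
  classical
  unfold capMass fpMass
  refine Finset.sum_le_sum fun n _ => ?_
  refine Finset.sum_le_sum_of_subset_of_nonneg ?_ fun _ _ _ => pow_nonneg ?_ n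
  · intro ω hω
    rw [Finset.mem_filter] at hω ⊢
    refine ⟨hω.1, hω.2.2, ?_⟩
    exact ⟨u + ω n, hω.2.1.2, rfl⟩
  · have h := SAW.Zd.connectiveConstant_pos 2
    rw [SAW.Zd.connectiveConstant_two] at h
    unfold SAW.criticalFugacity
    exact (inv_pos.2 h).le

/-! ### The dyadic sibling lemma (pure bookkeeping over a priced profile) -/

/-- window sum of a profile `p t ·` over `[a, a + w)`. -/
def wsum (p : ℤ → ℤ → ℝ) (t a w : ℤ) : ℝ := ∑ x ∈ Finset.Ico a (a + w), p t x

/-- NEAR-DIAGONAL DOUBLING (the research stub, stated for a priced profile `p`): at every depth `t`,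
every window of width `w ≤ 2^{-K} t` lying within distance `w` of the foot `x = 0` has each of its
two adjacent siblings carrying at least a `c`-fraction of its mass.  Only NEAR-DIAGONAL offsets are
involved (`w/t ≤ 2^{-K}`); the top `K` dyadic levels are never compared. -/
def NearDiagonalDoubling (p : ℤ → ℤ → ℝ) (c : ℝ) (K : ℕ) : Prop :=
  ∀ (t a w : ℤ), 1 ≤ w → (2 : ℝ) ^ K * w ≤ t → -2 * w ≤ a → a ≤ w →
    c * wsum p t a w ≤ wsum p t (a + w) w ∧ c * wsum p t a w ≤ wsum p t (a - w) w

/-- DYADIC SIBLING LEMMA (provable now).  If `p ≥ 0` has row sums ≤ 1 and near-diagonal doubling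
with constant `c > 0` below level `K`, then the central window of half-width `w` at depth `t`
carries mass ≤ `2 (1+c)^{K+1} (w/t)^{log₂(1+c)}`: climb the dyadic chain of windows containing the
foot, `mass(parent) = mass(child) + mass(sibling) ≥ (1+c) mass(child)`, and stop `K` levels below
the top where the trivial bound `≤ 1` is used. -/
theorem central_window_decay {p : ℤ → ℤ → ℝ} {c : ℝ} {K : ℕ} (hp0 : ∀ t x, 0 ≤ p t x)
    (hp1 : ∀ (t : ℤ) (s : Finset ℤ), ∑ x ∈ s, p t x ≤ 1) (hc : 0 < c)
    (hd : NearDiagonalDoubling p c K) :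
    ∀ (t w : ℤ), 1 ≤ w → (w : ℝ) ≤ t →
      wsum p t (-w) (2 * w) ≤ 2 * (1 + c) ^ (K + 1) * ((w : ℝ) / t) ^ Real.logb 2 (1 + c) := by
  sorry

/-- A PRICING of the first-passage profile from `u` in direction `q`: a nonnegative profile with row
sums ≤ 1 dominating the raw point masses.  The raw profile itself is one (by `fpMass_univ_le_one`);
the law of the first-passage variable `X_t` under Kesten's i.i.d.-irreducible-bridge measure is
another (completion weight `Q ≥ 1` on bridges) — the one for which doubling is natural. -/
def IsPricing (q u : Site 2) (p : ℤ → ℤ → ℝ) : Prop :=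
  (∀ t x, 0 ≤ p t x) ∧ (∀ (t : ℤ) (s : Finset ℤ), ∑ x ∈ s, p t x ≤ 1) ∧
    ∀ (t x : ℤ) (N : ℕ), 1 ≤ t → fpMass q u t {x} N ≤ p t x

/-! ### The two halves of the crux in frames, and the composition -/

/-- `u` is a depth-0 boundary point of the big disc in direction `q`, and `t` is the cap level:
every lattice point of `B(z,R)` other than `u` has positive `q`-depth, and every lattice point of the
closed target disc has `q`-depth ≥ `t ≥ 1` while the points of the open annulus first met... (only
the two inequalities below are used). -/
def IsFrame (q u : Site 2) (t : ℤ) (z : ℂ) (r R : ℝ) : Prop :=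
  q ≠ 0 ∧ 1 ≤ t ∧ (∀ v : Site 2, dist (Site.toComplex v) z < R → v ≠ u → 0 < dq q u v) ∧
    ∀ v : Site 2, dist (Site.toComplex v) z ≤ r → t ≤ dq q u v

/-- FRAME EXISTENCE (routine; cf. kesten-measure-pricing stub FRAME / ideator-2 normal frames):
every crux configuration admits a frame whose cap level is comparable to `R |q|` and whose cap window
has width comparable to `r |q|` — recorded here only through the two facts the composition uses. -/
def FrameExists : Prop :=
  ∀ (z : ℂ) (r R : ℝ), 1 ≤ r → r < R → ∀ u : Site 2, R ≤ dist (Site.toComplex u) z →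
    ∃ (q : Site 2) (t : ℤ), IsFrame q u t z r R

/-- CAP DECAY: uniform power bound for the record-type part, in every frame. (From IsPricing +
NearDiagonalDoubling + central_window_decay + capMass_le_fpMass; the geometric constants relating
`t`, the cap window and `r/R` are part of the frame bookkeeping.) -/
def CapDecay : Prop :=
  ∃ θ C : ℝ, 0 < θ ∧ ∀ (z : ℂ) (r R : ℝ), 1 ≤ r → r < R → ∀ (u q : Site 2) (t : ℤ),
    R ≤ dist (Site.toComplex u) z → IsFrame q u t z r R → ∀ N : ℕ,
      capMass q u t z r R N ≤ C * (r / R) ^ θ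

/-- SIDE DECAY (research stub, the shared enemy: non-record entries). -/
def SideDecay : Prop :=
  ∃ θ C : ℝ, 0 < θ ∧ ∀ (z : ℂ) (r R : ℝ), 1 ≤ r → r < R → ∀ (u q : Site 2) (t : ℤ),
    R ≤ dist (Site.toComplex u) z → IsFrame q u t z r R → ∀ N : ℕ,
      sideMass q u t z r R N ≤ C * (r / R) ^ θ

/-- The line concludes the crux by name. (Provable now: choose a frame, split, add, `min θ`.) -/
theorem annularMassDecay_of (hF : FrameExists) (hcap : CapDecay) (hside : SideDecay) :
    Summit.CriticalPhenomena.SAWScalingLimit.Theses.SAWRenewalTightness.AnnularMassDecay := by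
  classical
  obtain ⟨θ₁, C₁, hθ₁, h₁⟩ := hcap
  obtain ⟨θ₂, C₂, hθ₂, h₂⟩ := hside
  refine ⟨min θ₁ θ₂, max C₁ 0 + max C₂ 0, lt_min hθ₁ hθ₂, ?_⟩
  intro z r R hr hrR u hu N
  obtain ⟨q, t, hfr⟩ := hF z r R hr hrR u hu
  have hsplit := ann_eq_cap_add_side q u t z r R N
  have hx0 : 0 ≤ r / R := div_nonneg (by linarith) (by linarith)
  have hx1 : r / R ≤ 1 := (div_le_one (by linarith)).2 hrR.le
  have hmono : ∀ θ' : ℝ, min θ₁ θ₂ ≤ θ' → (r / R) ^ θ' ≤ (r / R) ^ min θ₁ θ₂ := by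
    intro θ' hθ'
    rcases hx0.eq_or_lt with h0 | hpos
    · rw [← h0, Real.zero_rpow (lt_min hθ₁ hθ₂).ne', Real.zero_rpow]
      exact ((lt_min hθ₁ hθ₂).trans_le hθ').ne'
    · exact Real.rpow_le_rpow_of_exponent_ge hpos hx1 hθ'
  have hc := h₁ z r R hr hrR u q t hu hfr N
  have hs := h₂ z r R hr hrR u q t hu hfr N
  have hpow₁ : 0 ≤ (r / R) ^ θ₁ := Real.rpow_nonneg hx0 _
  have hpow₂ : 0 ≤ (r / R) ^ θ₂ := Real.rpow_nonneg hx0 _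
  have hpow : 0 ≤ (r / R) ^ min θ₁ θ₂ := Real.rpow_nonneg hx0 _
  have hc' : capMass q u t z r R N ≤ max C₁ 0 * (r / R) ^ min θ₁ θ₂ :=
    hc.trans ((mul_le_mul_of_nonneg_right (le_max_left _ _) hpow₁).trans
      (mul_le_mul_of_nonneg_left (hmono θ₁ (min_le_left _ _)) (le_max_right _ _)))
  have hs' : sideMass q u t z r R N ≤ max C₂ 0 * (r / R) ^ min θ₁ θ₂ :=
    hs.trans ((mul_le_mul_of_nonneg_right (le_max_left _ _) hpow₂).trans
      (mul_le_mul_of_nonneg_left (hmono θ₂ (min_le_right _ _)) (le_max_right _ _)))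
  have key : capMass q u t z r R N + sideMass q u t z r R N ≤
      (max C₁ 0 + max C₂ 0) * (r / R) ^ min θ₁ θ₂ := by
    rw [add_mul]; exact add_le_add hc' hs'
  have hsplit' : (∑ n ∈ Finset.range (N + 1), ∑ _ω ∈ (SAW.Zd.saws 2 n).filter
      (fun ω => IsAnn z r R u n ω), SAW.criticalFugacity ^ n) ≤
      (max C₁ 0 + max C₂ 0) * (r / R) ^ min θ₁ θ₂ := hsplit ▸ key
  first
  | exact hsplit'
  | (convert hsplit' using 3; ext ω; simp only [Finset.mem_filter, IsAnn])

end

end Summit.CriticalPhenomena.SAWScalingLimit.Cruxes.AnnularMassDecay.Ideator3g2
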